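import Mathlib
import HarnessLib
import Literature.Probability.LatticeModels.IsingConsistency
import Summits.CriticalPhenomena.Ising3DConformalLimit.Theses.PlantedPinning
import Summits.CriticalPhenomena.Ising3DConformalLimit.Theorems.PlantedPinningPinningEfficiencyLeOne
import Summits.CriticalPhenomena.Ising3DConformalLimit.Theorems.PlantedPinningPinningEfficiencyDeficitOneStepDrop
import Summits.CriticalPhenomena.Ising3DConformalLimit.Theorems.PlantedPinningPinningEfficiencyDeficitRiccatiWithSlack

/-!
# `PinningEfficiencyDeficit` modulo the Cauchy–Schwarz slack, and the slack-free direction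
(route `PlantedPinning`, crux `PinningEfficiencyDeficit`, item stmt-CriticalPhenomena-8451: support)

Two sorry-free pieces of the birth line `S1 → S2 → S3 → PinningEfficiencyDeficit` of the crux
(skeleton `Cruxes/PinningEfficiencyDeficit/Lines/birth.lean`), now that S2 (`stub_oneStepDrop`)
and S3 (`stub_riccatiWithSlack`) have landed:

* `pvar_sq_le_csq_general` / `pvar_sq_le_csq`: the Cauchy–Schwarz/Jensen direction
  `(pvar j)² ≤ csq j` holds for EVERY finite-volume Ising model (any graph, volume, `β`, `h`, fixed
  boundary condition) — Cauchy–Schwarz over the new pin (`∑_{z ∉ P} Cov(M,σ_z | ·) = Var(M | ·)`),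
  Jensen over patterns, Cauchy–Schwarz over pin sets.  So the registered stub S1
  (`stub_csSlackWindow`: `(1+s)·(pvar L j)² ≤ csq L j` with `s > 0` uniformly on the density window)
  asks exactly for a STRICT, `p`-uniform improvement of an always-true inequality; with S2 the
  `s = 0` case is the ceiling step `v_{j+1} ≤ v_j − v_j²/(n−j)²` again.
* `pinningEfficiencyDeficit_of_csSlackWindow`: the crux `PinningEfficiencyDeficit` follows from the
  statement of S1 alone (S2, S3 and the ceiling `PinningEfficiencyLeOne` being theorems): the crux is
  closed MODULO the slack lower bound, which carries its whole `d = 3` / nearest-neighbour / `β = β_c`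
  content (it must fail where the scaling limit is Gaussian, cf. the route's crux
  `GaussianPinningSaturation`).

No definitions, no named facts; the hypothesis of `pinningEfficiencyDeficit_of_csSlackWindow` is the
registered signature of S1 verbatim (an explicit proposition, not a `def`).
-/

namespace Summit.CriticalPhenomena.Ising3DConformalLimit.PlantedPinningDeficit

open Finset MeasureTheory Literature.Probability.LatticeModels
open Summit.CriticalPhenomena.Ising3DConformalLimit.PlantedPinningCeiling
open Summit.CriticalPhenomena.Ising3DConformalLimit.Theses.PlantedPinning

/-! ### The slack-free direction `pvar² ≤ csq` -/

section Spins

variable {V Ω : Type*} [DecidableEq V] [Fintype Ω]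

variable (w : Ω → ℝ) (s : V → Ω → ℝ) (Λ : Finset V)
  {K : Finset V → Ω → Ω → ℝ} {E : Finset V → (Ω → ℝ) → Ω → ℝ}
  (hK1 : ∀ P a b, (∀ x ∈ P, s x a = s x b) → K P a b = 1)
  (hK0 : ∀ P a b, ¬ (∀ x ∈ P, s x a = s x b) → K P a b = 0)
  (hE : ∀ P f ω, E P f ω = (∑ ω', K P ω ω' * w ω' * f ω') / ∑ ω', K P ω ω' * w ω')

include hK1 hK0 hE in
/-- **Cauchy–Schwarz/Jensen direction of the slack functional**, abstract finite form: with
`v(P) = 𝔼_w Var(M | s|_P)`, `pvar j = (n choose j)⁻¹ ∑_{|P| = j} v(P)` and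
`csq j = (n choose j)⁻¹ ∑_{|P| = j} 𝔼_w[(n − j) ∑_{z ∈ Λ ∖ P} Cov(M, s_z | s|_P)²]`,
`(pvar j)² ≤ csq j` for `j < n = |Λ|` (Cauchy–Schwarz over `z` with
`∑_{z ∉ P} Cov(M, s_z | ·) = Var(M | ·)`, Jensen over `ω`, Cauchy–Schwarz over `P`;
Raghavendra–Tan 2012, proof of Lemma 4.3). [folklore] -/
theorem pvar_sq_le_csq_abstract (hw : ∀ ω, 0 < w ω) (hw1 : ∑ ω, w ω = 1) (M : Ω → ℝ)
    (hM : ∀ ω, M ω = ∑ x ∈ Λ, s x ω) {j : ℕ} (hj : j < #Λ) :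
    ((∑ P ∈ Λ.powersetCard j, ∑ ω, w ω * (E P (fun ω => M ω ^ 2) ω - (E P M ω) ^ 2)) /
        ((#Λ).choose j : ℝ)) ^ 2 ≤
      (∑ P ∈ Λ.powersetCard j, ∑ ω, w ω * (((#Λ : ℝ) - j) *
          ∑ z ∈ Λ \ P, (E P (fun ω => M ω * s z ω) ω - E P M ω * E P (s z) ω) ^ 2)) /
        ((#Λ).choose j : ℝ) := by
  set n := #Λ with hn
  set X : Finset V → Ω → ℝ := fun P ω => E P (fun ω => M ω ^ 2) ω - (E P M ω) ^ 2 with hX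
  set Cz : Finset V → V → Ω → ℝ := fun P z ω =>
    E P (fun ω => M ω * s z ω) ω - E P M ω * E P (s z) ω with hCz
  set a : Finset V → ℝ := fun P => ∑ ω, w ω * X P ω with ha
  set Cj : ℝ := (n.choose j : ℝ) with hCj
  set m : ℝ := (n : ℝ) - j with hm
  have hCpos : 0 < Cj := by rw [hCj]; exact_mod_cast Nat.choose_pos hj.le
  have hmpos : 0 < m := by
    have : (j : ℝ) + 1 ≤ n := by exact_mod_cast hj
    rw [hm]; linarith
  have hcardT : ∀ P ∈ Λ.powersetCard j, (#(Λ \ P) : ℝ) = m := by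
    intro P hP
    obtain ⟨hPΛ, hPc⟩ := Finset.mem_powersetCard.1 hP
    rw [Finset.card_sdiff_of_subset hPΛ, hPc, Nat.cast_sub hj.le, hm]
  -- pointwise in `(P, ω)`: `X² ≤ m ∑_z C_z²` (Cauchy–Schwarz over `z`, `∑_z C_z = X`)
  have hcs : ∀ P ∈ Λ.powersetCard j, ∀ ω, (X P ω) ^ 2 ≤ m * ∑ z ∈ Λ \ P, (Cz P z ω) ^ 2 := by
    intro P hP ω
    obtain ⟨hPΛ, _⟩ := Finset.mem_powersetCard.1 hP
    have hsumC : ∑ z ∈ Λ \ P, Cz P z ω = X P ω :=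
      sum_condCov_eq_condVar w s Λ hK1 hK0 hE hw hPΛ hM ω
    have h := sq_sum_le_card_mul_sum_sq (s := Λ \ P) (f := fun z => Cz P z ω)
    rw [hsumC, hcardT P hP] at h
    exact h
  -- Jensen over `ω`: `a(P)² ≤ ∑ w X²  ≤ ∑ w (m ∑ C²)`
  have hjensen : ∀ P ∈ Λ.powersetCard j,
      (a P) ^ 2 ≤ ∑ ω, w ω * (m * ∑ z ∈ Λ \ P, (Cz P z ω) ^ 2) := by
    intro P hP
    calc (a P) ^ 2 ≤ ∑ ω, w ω * (X P ω) ^ 2 := sq_wsum_le_wsum_sq (fun ω => (hw ω).le) hw1 (X P)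
      _ ≤ _ := Finset.sum_le_sum fun ω _ => mul_le_mul_of_nonneg_left (hcs P hP ω) (hw ω).le
  -- Cauchy–Schwarz over `P`: `(∑ a)² ≤ C ∑ a²`
  have hcsP : (∑ P ∈ Λ.powersetCard j, a P) ^ 2 ≤ Cj * ∑ P ∈ Λ.powersetCard j, (a P) ^ 2 := by
    have h := sq_sum_le_card_mul_sum_sq (s := Λ.powersetCard j) (f := a)
    rw [Finset.card_powersetCard, ← hn] at h
    rw [hCj]; exact h
  have hsum : ∑ P ∈ Λ.powersetCard j, (a P) ^ 2 ≤
      ∑ P ∈ Λ.powersetCard j, ∑ ω, w ω * (m * ∑ z ∈ Λ \ P, (Cz P z ω) ^ 2) :=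
    Finset.sum_le_sum hjensen
  rw [div_pow, div_le_div_iff₀ (pow_pos hCpos 2) hCpos]
  calc (∑ P ∈ Λ.powersetCard j, a P) ^ 2 * Cj
      ≤ (Cj * ∑ P ∈ Λ.powersetCard j, (a P) ^ 2) * Cj :=
        mul_le_mul_of_nonneg_right hcsP hCpos.le
    _ ≤ (Cj * ∑ P ∈ Λ.powersetCard j, ∑ ω, w ω * (m * ∑ z ∈ Λ \ P, (Cz P z ω) ^ 2)) * Cj :=
        mul_le_mul_of_nonneg_right (mul_le_mul_of_nonneg_left hsum hCpos.le) hCpos.le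
    _ = _ := by ring

end Spins

/-- **`(pvar j)² ≤ csq j` for the finite-volume Ising model** on any locally finite graph, any
volume `Λ` (`n = |Λ|`), any `β, h` and any fixed boundary condition `η₀`, `j < n`, with
`w = w^{η₀}_Λ / Z^{η₀}_Λ`, `M = ∑_{x ∈ Λ} σ_x`,
`pvar j = (n choose j)⁻¹ ∑_{|P| = j} ∑_τ w(τ) Var^{τ ∨ η₀}_{Λ ∖ P}(M)`,
`csq j = (n choose j)⁻¹ ∑_{|P| = j} ∑_τ w(τ) (n − j) ∑_{z ∈ Λ ∖ P} Cov^{τ ∨ η₀}_{Λ ∖ P}(M, σ_z)²`: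
the Cauchy–Schwarz/Jensen direction of the slack functional of the pinning flow
(`pvar_sq_le_csq_abstract` transported through the finite-volume DLR identity
`sum_kernel_isingWeight_eq`, Friedli–Velenik 2017, Lemma 6.7). [folklore] -/
theorem pvar_sq_le_csq_general {V : Type*} [DecidableEq V] (G : SimpleGraph V) [G.LocallyFinite]
    (Λ : Finset V) (β h : ℝ) (η₀ : SpinConfig V) {j : ℕ} (hj : j < #Λ) :
    ((∑ P ∈ Λ.powersetCard j, ∑ τ : Λ → ℤˣ,
        isingWeight G Λ β h (.fixed η₀) τ / isingPartitionFunction G Λ β h (.fixed η₀) *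
          (isingExpect G (Λ \ P) β h (.fixed (glue Λ τ (.fixed η₀)))
              (fun σ => (∑ x ∈ Λ, spinAt x σ) ^ 2) -
            isingExpect G (Λ \ P) β h (.fixed (glue Λ τ (.fixed η₀)))
              (fun σ => ∑ x ∈ Λ, spinAt x σ) ^ 2)) / ((#Λ).choose j : ℝ)) ^ 2 ≤
      (∑ P ∈ Λ.powersetCard j, ∑ τ : Λ → ℤˣ,
        isingWeight G Λ β h (.fixed η₀) τ / isingPartitionFunction G Λ β h (.fixed η₀) *
          ((((#Λ : ℕ) : ℝ) - j) * ∑ z ∈ Λ \ P,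
            (isingExpect G (Λ \ P) β h (.fixed (glue Λ τ (.fixed η₀)))
                (fun σ => (∑ x ∈ Λ, spinAt x σ) * spinAt z σ) -
              isingExpect G (Λ \ P) β h (.fixed (glue Λ τ (.fixed η₀)))
                (fun σ => ∑ x ∈ Λ, spinAt x σ) *
              isingExpect G (Λ \ P) β h (.fixed (glue Λ τ (.fixed η₀)))
                (fun σ => spinAt z σ)) ^ 2)) / ((#Λ).choose j : ℝ) := by
  classical
  -- weights `w = w^{η₀}_Λ / Z`
  set W : (Λ → ℤˣ) → ℝ := isingWeight G Λ β h (.fixed η₀) with hW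
  set Z : ℝ := isingPartitionFunction G Λ β h (.fixed η₀) with hZ
  have hZpos : 0 < Z := isingPartitionFunction_pos G Λ β h (.fixed η₀)
  set w : (Λ → ℤˣ) → ℝ := fun τ => W τ / Z with hw
  have hwpos : ∀ τ, 0 < w τ := fun τ => div_pos (isingWeight_pos G Λ β h _ τ) hZpos
  have hw1 : ∑ τ, w τ = 1 := by
    simp only [hw]
    rw [← Finset.sum_div, div_eq_one_iff_eq hZpos.ne']
    rfl
  -- spins `s x τ = (τ ∨ η₀)_x`
  set s : V → (Λ → ℤˣ) → ℝ := fun x τ => spinAt x (glue Λ τ (.fixed η₀)) with hs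
  -- agreement kernels and conditional expectations given the spins on `P`
  set K : Finset V → (Λ → ℤˣ) → (Λ → ℤˣ) → ℝ :=
    fun P a b => if ∀ x ∈ P, s x a = s x b then 1 else 0 with hK
  have hK1 : ∀ P a b, (∀ x ∈ P, s x a = s x b) → K P a b = 1 := fun P a b hab => by
    simp only [hK, if_pos hab]
  have hK0 : ∀ P a b, ¬ (∀ x ∈ P, s x a = s x b) → K P a b = 0 := fun P a b hab => by
    simp only [hK, if_neg hab]
  set E : Finset V → ((Λ → ℤˣ) → ℝ) → (Λ → ℤˣ) → ℝ :=
    fun P g τ => (∑ σ, K P τ σ * w σ * g σ) / ∑ σ, K P τ σ * w σ with hE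
  have hEeq : ∀ P g τ, E P g τ = (∑ σ, K P τ σ * w σ * g σ) / ∑ σ, K P τ σ * w σ :=
    fun _ _ _ => rfl
  set Mt : (Λ → ℤˣ) → ℝ := fun τ => ∑ x ∈ Λ, s x τ with hMt
  have hMeq : ∀ τ, Mt τ = ∑ x ∈ Λ, s x τ := fun _ => rfl
  -- the abstract inequality
  have hmain := pvar_sq_le_csq_abstract w s Λ hK1 hK0 hEeq hwpos hw1 Mt hMeq hj
  -- DLR: planted conditional moments are conditional moments given the spins on `P`
  have hm1 : Measurable (fun σ : SpinConfig V => ∑ x ∈ Λ, spinAt x σ) :=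
    Finset.measurable_sum _ fun x _ => measurable_spinAt x
  have hm2 : Measurable (fun σ : SpinConfig V => (∑ x ∈ Λ, spinAt x σ) ^ 2) := hm1.pow_const 2
  have hm3 : ∀ z : V, Measurable (fun σ : SpinConfig V => (∑ x ∈ Λ, spinAt x σ) * spinAt z σ) :=
    fun z => hm1.mul (measurable_spinAt z)
  have hm4 : ∀ z : V, Measurable (fun σ : SpinConfig V => spinAt z σ) := fun z =>
    measurable_spinAt z
  have key : ∀ P, P ⊆ Λ → ∀ τ : Λ → ℤˣ, ∀ {f : SpinConfig V → ℝ}, Measurable f →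
      E P (fun σ => f (glue Λ σ (.fixed η₀))) τ =
        isingExpect G (Λ \ P) β h (.fixed (glue Λ τ (.fixed η₀))) f := by
    intro P hP τ f hf
    obtain ⟨_, h01, hrefl, _, _⟩ := agreeKernel_props s hK1 hK0 P
    have hKW : 0 < ∑ σ, K P τ σ * W σ :=
      ksum_one_pos W (K P) (fun σ => isingWeight_pos G Λ β h _ σ) h01 hrefl τ
    have hdlr := sum_kernel_isingWeight_eq G hP β h η₀ (K := K P) (hK1 P) (hK0 P) τ hf
    have h1 : ∑ σ, K P τ σ * w σ * f (glue Λ σ (.fixed η₀)) =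
        (∑ σ, K P τ σ * W σ * f (glue Λ σ (.fixed η₀))) / Z := by
      rw [Finset.sum_div]
      exact Finset.sum_congr rfl fun σ _ => by simp only [hw]; ring
    have h2 : ∑ σ, K P τ σ * w σ = (∑ σ, K P τ σ * W σ) / Z := by
      rw [Finset.sum_div]
      exact Finset.sum_congr rfl fun σ _ => by simp only [hw]; ring
    rw [hEeq, h1, h2, div_div_div_cancel_right₀ hZpos.ne', hdlr, mul_div_cancel_left₀ _ hKW.ne']
  have hcv : ∀ P, P ⊆ Λ → ∀ τ : Λ → ℤˣ,
      isingExpect G (Λ \ P) β h (.fixed (glue Λ τ (.fixed η₀))) (fun σ => (∑ x ∈ Λ, spinAt x σ) ^ 2) -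
        isingExpect G (Λ \ P) β h (.fixed (glue Λ τ (.fixed η₀))) (fun σ => ∑ x ∈ Λ, spinAt x σ) ^ 2 =
      E P (fun τ => Mt τ ^ 2) τ - (E P Mt τ) ^ 2 := by
    intro P hP τ
    rw [← key P hP τ hm1, ← key P hP τ hm2]
  have hcc : ∀ P, P ⊆ Λ → ∀ (τ : Λ → ℤˣ) (z : V),
      isingExpect G (Λ \ P) β h (.fixed (glue Λ τ (.fixed η₀)))
          (fun σ => (∑ x ∈ Λ, spinAt x σ) * spinAt z σ) -
        isingExpect G (Λ \ P) β h (.fixed (glue Λ τ (.fixed η₀))) (fun σ => ∑ x ∈ Λ, spinAt x σ) *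
          isingExpect G (Λ \ P) β h (.fixed (glue Λ τ (.fixed η₀))) (fun σ => spinAt z σ) =
      E P (fun τ => Mt τ * s z τ) τ - E P Mt τ * E P (s z) τ := by
    intro P hP τ z
    rw [← key P hP τ hm1, ← key P hP τ (hm3 z), ← key P hP τ (hm4 z)]
  have hsum : ∑ P ∈ Λ.powersetCard j, ∑ τ : Λ → ℤˣ, W τ / Z *
        (isingExpect G (Λ \ P) β h (.fixed (glue Λ τ (.fixed η₀))) (fun σ => (∑ x ∈ Λ, spinAt x σ) ^ 2) -
          isingExpect G (Λ \ P) β h (.fixed (glue Λ τ (.fixed η₀))) (fun σ => ∑ x ∈ Λ, spinAt x σ) ^ 2) =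
      ∑ P ∈ Λ.powersetCard j, ∑ τ, w τ * (E P (fun τ => Mt τ ^ 2) τ - (E P Mt τ) ^ 2) :=
    Finset.sum_congr rfl fun P hP => Finset.sum_congr rfl fun τ _ => by
      rw [hcv P (Finset.mem_powersetCard.1 hP).1 τ]
  have hsumc : ∑ P ∈ Λ.powersetCard j, ∑ τ : Λ → ℤˣ, W τ / Z *
        ((((#Λ : ℕ) : ℝ) - j) * ∑ z ∈ Λ \ P,
          (isingExpect G (Λ \ P) β h (.fixed (glue Λ τ (.fixed η₀)))
              (fun σ => (∑ x ∈ Λ, spinAt x σ) * spinAt z σ) -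
            isingExpect G (Λ \ P) β h (.fixed (glue Λ τ (.fixed η₀)))
              (fun σ => ∑ x ∈ Λ, spinAt x σ) *
            isingExpect G (Λ \ P) β h (.fixed (glue Λ τ (.fixed η₀)))
              (fun σ => spinAt z σ)) ^ 2) =
      ∑ P ∈ Λ.powersetCard j, ∑ τ, w τ * ((((#Λ : ℕ) : ℝ) - j) *
        ∑ z ∈ Λ \ P, (E P (fun τ => Mt τ * s z τ) τ - E P Mt τ * E P (s z) τ) ^ 2) :=
    Finset.sum_congr rfl fun P hP => Finset.sum_congr rfl fun τ _ => by
      rw [Finset.sum_congr rfl fun z _ => by rw [hcc P (Finset.mem_powersetCard.1 hP).1 τ z]]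
  rw [hsum, hsumc]
  exact hmain

/-- **`(pvar L j)² ≤ csq L j`** for the critical `+`-boundary Ising box `box 3 L` on `ℤ³`
(`β = β_c(3)`, `h = 0`), all `L` and `j < n = |box 3 L|`, in the spelling of the registered stubs of
the crux `PinningEfficiencyDeficit` (so stub S1 `stub_csSlackWindow` asks for the STRICT,
`p`-uniform version `(1+s)·(pvar L j)² ≤ csq L j` of an always-true inequality).
Instance of `pvar_sq_le_csq_general`. [folklore] -/
theorem pvar_sq_le_csq : (fun (βc : ℝ) (M : ℕ → Literature.Probability.LatticeModels.SpinConfig (Literature.Probability.LatticeModels.Site 3) → ℝ) => (fun (pvar csq : ℕ → ℕ → ℝ) => ∀ L j : ℕ, j < (Literature.Probability.LatticeModels.box 3 L).card → pvar L j ^ 2 ≤ csq L j) (fun (L k : ℕ) => (∑ P ∈ (Literature.Probability.LatticeModels.box 3 L).powersetCard k, ∑ τ : ↥(Literature.Probability.LatticeModels.box 3 L) → ℤˣ, Literature.Probability.LatticeModels.isingWeight (Literature.Probability.LatticeModels.zdGraph 3) (Literature.Probability.LatticeModels.box 3 L) βc 0 .plus τ / Literature.Probability.LatticeModels.isingPartitionFunction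 (Literature.Probability.LatticeModels.zdGraph 3) (Literature.Probability.LatticeModels.box 3 L) βc 0 .plus * (Literature.Probability.LatticeModels.isingExpect (Literature.Probability.LatticeModels.zdGraph 3) (Literature.Probability.LatticeModels.box 3 L \ P) βc 0 (.fixed (Literature.Probability.LatticeModels.glue (Literature.Probability.LatticeModels.box 3 L) τ .plus)) (fun σ => M L σ ^ 2) - Literature.Probability.LatticeModels.isingExpect (Literature.Probability.LatticeModels.zdGraph 3) (Literature.Probability.LatticeModels.box 3 L \ P) βc 0 (.fixed (Literature.Probability.LatticeModels.glue (Literature.Probability.LatticeModels.box 3 L) τ .plus)) (M L) ^ 2)) / ((Literature.Probability.LatticeModels.box 3 L).card.choose k : ℝ)) (fun (L j : ℕ) => (∑ P ∈ (Literature.Probability.LatticeModels.box 3 L).powersetCard j, ∑ τ : ↥(Literature.Probability.LatticeModels.box 3 L) → ℤˣ, Literature.Probability.LatticeModels.isingWeight (Literature.Probability.LatticeModels.zdGraph 3) (Literature.Probability.LatticeModels.box 3 L) βc 0 .plus τ / Literature.Probability.LatticeModels.isingPartitionFunction (Literature.Probability.LatticeModels.zdGraph 3) (Literature.Probability.LatticeModels.box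 3 L) βc 0 .plus * ((((Literature.Probability.LatticeModels.box 3 L).card : ℝ) - j) * ∑ z ∈ Literature.Probability.LatticeModels.box 3 L \ P, (Literature.Probability.LatticeModels.isingExpect (Literature.Probability.LatticeModels.zdGraph 3) (Literature.Probability.LatticeModels.box 3 L \ P) βc 0 (.fixed (Literature.Probability.LatticeModels.glue (Literature.Probability.LatticeModels.box 3 L) τ .plus)) (fun σ => M L σ * Literature.Probability.LatticeModels.spinAt z σ) - Literature.Probability.LatticeModels.isingExpect (Literature.Probability.LatticeModels.zdGraph 3) (Literature.Probability.LatticeModels.box 3 L \ P) βc 0 (.fixed (Literature.Probability.LatticeModels.glue (Literature.Probability.LatticeModels.box 3 L) τ .plus)) (M L) * Literature.Probability.LatticeModels.isingExpect (Literature.Probability.LatticeModels.zdGraph 3) (Literature.Probability.LatticeModels.box 3 L \ P) βc 0 (.fixed (Literature.Probability.LatticeModels.glue (Literature.Probability.LatticeModels.box 3 L) τ .plus)) (fun σ => Literature.Probability.LatticeModels.spinAt z σ)) ^ 2)) / ((Literature.Probability.LatticeModels.box 3 L).card.choose j : ℝ))) (Literature.Probability.LatticeModels.criticalBeta 3) (fun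 (L : ℕ) (σ : Literature.Probability.LatticeModels.SpinConfig (Literature.Probability.LatticeModels.Site 3)) => ∑ x ∈ Literature.Probability.LatticeModels.box 3 L, Literature.Probability.LatticeModels.spinAt x σ) := by
  intro L j hj
  exact pvar_sq_le_csq_general (zdGraph 3) (box 3 L) (criticalBeta 3) 0 1 hj

/-! ### The crux modulo S1 -/

/-- Glue: a one-step drop `v (j+1) ≤ v j − c j/(n−j)²` (`j < n`) and a slack bound
`(1+s) (v j)² ≤ c j` on the window `k ≤ 2j`, `j < k ≤ n` give the slacked Riccati step on the
window. [folklore] -/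
theorem slackedStep_of_drop_of_slack {v c : ℕ → ℝ} {n k : ℕ} {s : ℝ} (hkn : k ≤ n)
    (hdrop : ∀ j : ℕ, j < n → v (j + 1) ≤ v j - c j / ((n : ℝ) - j) ^ 2)
    (hslack : ∀ j : ℕ, k ≤ 2 * j → j < k → (1 + s) * v j ^ 2 ≤ c j) :
    ∀ j : ℕ, k ≤ 2 * j → j < k → v (j + 1) ≤ v j - (1 + s) * v j ^ 2 / ((n : ℝ) - j) ^ 2 := by
  intro j hj1 hj2
  have hjn : j < n := lt_of_lt_of_le hj2 hkn
  have h1 := hdrop j hjn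
  have h2 := hslack j hj1 hj2
  have h3 : (1 + s) * v j ^ 2 / ((n : ℝ) - j) ^ 2 ≤ c j / ((n : ℝ) - j) ^ 2 :=
    div_le_div_of_nonneg_right h2 (sq_nonneg _)
  linarith

/-- **The crux `PinningEfficiencyDeficit` modulo the Cauchy–Schwarz slack S1.**  If the planted
pinning flow of the critical Ising box on `ℤ³` has a `p`-uniform strict slack
`(1+s)·(pvar L j)² ≤ csq L j` (`s > 0`) at every pin number `j` of the density window
`⌈p n⌉ ≤ 2j < 2⌈p n⌉` for all `L ≥ L₀(p)` and all `p < p₀` — the hypothesis is the registered stub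
`stub_csSlackWindow` of the crux's birth line VERBATIM — then `e* < 1`:
`∃ ε > 0 ∃ p₀ > 0 ∀ p ∈ (0,p₀) ∃ L₀ ∀ L ≥ L₀, e_L(⌈p n⌉) ≤ 1 − ε` with `ε = 1 − 1/(1+s/3)`.
Composition of the landed S2 (`stub_oneStepDrop`), S3 (`stub_riccatiWithSlack`) and the ceiling
`PinningEfficiencyLeOne` (`pinningEfficiencyLeOne_proof`, item 8455); `n = (2L+1)³ ≥ L`
(`card_box`) gives `2 ≤ ⌈p n⌉ ≤ n` for `L ≥ ⌈2/p⌉`, `p < 1`.  This is a CONDITIONAL result: S1 is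
the open `d = 3` content of the crux (it must fail for a Gaussian scaling limit). [folklore] -/
theorem pinningEfficiencyDeficit_of_csSlackWindow : (fun (βc : ℝ) (M : ℕ → Literature.Probability.LatticeModels.SpinConfig (Literature.Probability.LatticeModels.Site 3) → ℝ) => (fun (pvar csq : ℕ → ℕ → ℝ) => ∃ s : ℝ, 0 < s ∧ ∃ p₀ : ℝ, 0 < p₀ ∧ ∀ p : ℝ, 0 < p → p < p₀ → ∃ L₀ : ℕ, ∀ L ≥ L₀, ∀ j : ℕ, ⌈p * ((Literature.Probability.LatticeModels.box 3 L).card : ℝ)⌉₊ ≤ 2 * j → j < ⌈p * ((Literature.Probability.LatticeModels.box 3 L).card : ℝ)⌉₊ → (1 + s) * pvar L j ^ 2 ≤ csq L j) (fun (L k : ℕ) => (∑ P ∈ (Literature.Probability.LatticeModels.box 3 L).powersetCard k, ∑ τ : ↥(Literature.Probability.LatticeModels.box 3 L) → ℤˣ, Literature.Probability.LatticeModels.isingWeight (Literature.Probability.LatticeModels.zdGraph 3) (Literature.Probability.LatticeModels.box 3 L) βc 0 .plus τ / Literature.Probability.LatticeModels.isingPartitionFunction (Literature.Probability.LatticeModels.zdGraph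 3) (Literature.Probability.LatticeModels.box 3 L) βc 0 .plus * (Literature.Probability.LatticeModels.isingExpect (Literature.Probability.LatticeModels.zdGraph 3) (Literature.Probability.LatticeModels.box 3 L \ P) βc 0 (.fixed (Literature.Probability.LatticeModels.glue (Literature.Probability.LatticeModels.box 3 L) τ .plus)) (fun σ => M L σ ^ 2) - Literature.Probability.LatticeModels.isingExpect (Literature.Probability.LatticeModels.zdGraph 3) (Literature.Probability.LatticeModels.box 3 L \ P) βc 0 (.fixed (Literature.Probability.LatticeModels.glue (Literature.Probability.LatticeModels.box 3 L) τ .plus)) (M L) ^ 2)) / ((Literature.Probability.LatticeModels.box 3 L).card.choose k : ℝ)) (fun (L j : ℕ) => (∑ P ∈ (Literature.Probability.LatticeModels.box 3 L).powersetCard j, ∑ τ : ↥(Literature.Probability.LatticeModels.box 3 L) → ℤˣ, Literature.Probability.LatticeModels.isingWeight (Literature.Probability.LatticeModels.zdGraph 3) (Literature.Probability.LatticeModels.box 3 L) βc 0 .plus τ / Literature.Probability.LatticeModels.isingPartitionFunction (Literature.Probability.LatticeModels.zdGraph 3) (Literature.Probability.LatticeModels.box 3 L) βc 0 .plus * ((((Literature.Probability.LatticeModels.box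 3 L).card : ℝ) - j) * ∑ z ∈ Literature.Probability.LatticeModels.box 3 L \ P, (Literature.Probability.LatticeModels.isingExpect (Literature.Probability.LatticeModels.zdGraph 3) (Literature.Probability.LatticeModels.box 3 L \ P) βc 0 (.fixed (Literature.Probability.LatticeModels.glue (Literature.Probability.LatticeModels.box 3 L) τ .plus)) (fun σ => M L σ * Literature.Probability.LatticeModels.spinAt z σ) - Literature.Probability.LatticeModels.isingExpect (Literature.Probability.LatticeModels.zdGraph 3) (Literature.Probability.LatticeModels.box 3 L \ P) βc 0 (.fixed (Literature.Probability.LatticeModels.glue (Literature.Probability.LatticeModels.box 3 L) τ .plus)) (M L) * Literature.Probability.LatticeModels.isingExpect (Literature.Probability.LatticeModels.zdGraph 3) (Literature.Probability.LatticeModels.box 3 L \ P) βc 0 (.fixed (Literature.Probability.LatticeModels.glue (Literature.Probability.LatticeModels.box 3 L) τ .plus)) (fun σ => Literature.Probability.LatticeModels.spinAt z σ)) ^ 2)) / ((Literature.Probability.LatticeModels.box 3 L).card.choose j : ℝ))) (Literature.Probability.LatticeModels.criticalBeta 3) (fun (L : ℕ) (σ : Literature.Probability.LatticeModels.SpinConfig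 (Literature.Probability.LatticeModels.Site 3)) => ∑ x ∈ Literature.Probability.LatticeModels.box 3 L, Literature.Probability.LatticeModels.spinAt x σ) → Summit.CriticalPhenomena.Ising3DConformalLimit.Theses.PlantedPinning.PinningEfficiencyDeficit := by
  intro h1
  have h2 := stub_oneStepDrop
  have h3 := stub_riccatiWithSlack
  dsimp only at h1 h2
  obtain ⟨s, hs, p₀, hp₀, hwin⟩ := h1
  have hs3 : (0 : ℝ) < 1 + s / 3 := by linarith
  have hε : (0 : ℝ) < 1 - 1 / (1 + s / 3) := by
    have : 1 / (1 + s / 3) < 1 := (div_lt_one hs3).mpr (by linarith)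
    linarith
  refine ⟨1 - 1 / (1 + s / 3), hε, min p₀ 1, lt_min hp₀ one_pos, ?_⟩
  intro p hp hpp
  have hp0 : p < p₀ := lt_of_lt_of_le hpp (min_le_left _ _)
  have hp1 : p < 1 := lt_of_lt_of_le hpp (min_le_right _ _)
  obtain ⟨L₀, hL₀⟩ := hwin p hp hp0
  refine ⟨max L₀ ⌈2 / p⌉₊, ?_⟩
  intro L hL
  have hLL₀ : L₀ ≤ L := le_trans (le_max_left _ _) hL
  have hLceil : ⌈2 / p⌉₊ ≤ L := le_trans (le_max_right _ _) hL
  have hwinL := hL₀ L hLL₀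
  -- the box `Λ_L` has `n = (2L+1)³ ≥ L` sites, so `p·n ≥ p·L ≥ 2 > 1` and `2 ≤ k = ⌈p n⌉ ≤ n`
  set n : ℕ := (Literature.Probability.LatticeModels.box 3 L).card with hn
  have hnL : L ≤ n := by
    rw [hn, Literature.Probability.LatticeModels.card_box]
    calc L ≤ 2 * L + 1 := by omega
      _ ≤ (2 * L + 1) ^ 3 := Nat.le_self_pow (by norm_num) _
  have hnR : (L : ℝ) ≤ n := by exact_mod_cast hnL
  have hLp : 2 / p ≤ (L : ℝ) := le_trans (Nat.le_ceil _) (by exact_mod_cast hLceil)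
  have hp' : p ≠ 0 := hp.ne'
  have h2p : p * (2 / p) = 2 := by field_simp
  have hpL : 2 ≤ p * (L : ℝ) := by
    calc (2 : ℝ) = p * (2 / p) := h2p.symm
      _ ≤ p * L := mul_le_mul_of_nonneg_left hLp hp.le
  have hpn : (1 : ℝ) < p * n := by
    have := mul_le_mul_of_nonneg_left hnR hp.le
    linarith
  set k : ℕ := ⌈p * (n : ℝ)⌉₊ with hk
  have hk2 : 2 ≤ k := by
    have h1k : 1 < k := Nat.lt_ceil.mpr (by exact_mod_cast hpn)
    omega
  have hkn : k ≤ n := by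
    refine Nat.ceil_le.mpr ?_
    exact mul_le_of_le_one_left (Nat.cast_nonneg n) hp1.le
  -- slacked Riccati step on the window `[k/2, k)` from S2 (drop) and S1 (slack)
  have hstep := slackedStep_of_drop_of_slack hkn (h2 L) hwinL
  -- integrate with S3, using the landed ceiling `PinningEfficiencyLeOne` (item 8455) at `L`
  have key := h3 n k s _ hs.le hk2 hkn
    (Summit.CriticalPhenomena.Ising3DConformalLimit.PlantedPinningCeiling.pinningEfficiencyLeOne_proof L)
    hstep
  have e : (1 : ℝ) - (1 - 1 / (1 + s / 3)) = 1 / (1 + s / 3) := by ring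
  rw [e]
  exact key

end Summit.CriticalPhenomena.Ising3DConformalLimit.PlantedPinningDeficit
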